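import Summits.RiemannHypothesis.RiemannHypothesis.Theorems.LiEchoDirichletDefs
import Summits.RiemannHypothesis.RiemannHypothesis.Theorems.LiPrimeEchoNonresonant
import HarnessLib

/-!
# RiemannHypothesis / LiDirichletEcho — crux K2χ `LiPrimeEdgeEchoChar`, part 1: the non-resonant remainder of the
# prime edge of `L(s, χ)` is `O_c(1)` (RH-FREE, GRH-FREE)

RH-FREE · GRH-FREE [rh-li-eng g5, acting as prover on the unstaffed route].  Route `Theses/LiDirichletEcho.lean` (rung
«Li PRIME-ECHO LAW FOR DIRICHLET CHARACTERS» `LiTheory.LiZeroWindowEchoDirichlet`, L-P(P1χ); cell `pub/rh-li`), item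
`LiPrimeEdgeEchoChar` (stmt-RiemannHypothesis-19393), stub E₂χ of the birth skeleton (`stub_nonresonant_char`): for every
Dirichlet character `χ` mod `q` and every `c ≥ 1` there is `C = C(c)` (the SAME constant as for `ζ`, independent of `χ`
and `q`) with

  `|charPrimeEdge χ n T₁ T₂ − charEdgeTwo χ n T₁ T₂| ≤ C`   (`n ≥ 1`, `√n ≤ T₁ ≤ T₂ ≤ c√n + 1`),

where `charEdgeTwo χ n T₁ T₂ = (1/π) Re[χ(2) · ∫ Λ(2) 2^{−w} z⁻ⁿ dy]` is `χ(2)` times ζ's resonant integral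
(`PrimeEdge.edgeTwo`).  Proof = the ζ proof (`PrimeEdge.liPrimeEdge_nonresonant`, route LiPrimeEcho, CLOSED·proved)
re-run with the coefficients `χ(m)Λ(m)`: `‖χ(m)Λ(m) m^{−w}‖ ≤ Λ(m) m^{−3/2}` on `Re w = 3/2` (`‖χ(m)‖ ≤ 1`), so the
integral of `L(χΛ, w) k_n(w)` is the sum of the term integrals (dominated convergence), each bounded by the ζ route's
first-derivative tests `PrimeEdge.norm_integral_plus_le` / `PrimeEdge.norm_integral_minus_le` — every `F_n(w)` term and
every `F_n(1 − w)` term with `m ≠ 2` — and `Σ Λ(m) m^{−3/2} < ∞`.  Nothing here bears on the truth of RH or GRH.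
-/

noncomputable section

-- D-0017: `Summit.<S>.<S>.…` is the designed namespace of a single-problem summit.
set_option linter.dupNamespace false

open Complex MeasureTheory intervalIntegral Set
open scoped Real Interval ArithmeticFunction.vonMangoldt

namespace Summit.RiemannHypothesis.RiemannHypothesis.Theorems.LiTheory

namespace CharPrimeEdge

open PrimeEdge

variable {q : ℕ}

/-- The RESONANT piece of the prime edge of `L(s, χ)`: the `m = 2` term `χ(2)Λ(2) 2^{−w}` against the reflected weight
`F_n(1 − w) = z⁻ⁿ`, i.e. `(1/π) Re[χ(2) · ∫_{T₁}^{T₂} Λ(2) 2^{−w} z⁻ⁿ dy]` — ζ's resonant integral times the constant `χ(2)`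
(`(1/π) Re` of the same integral is `PrimeEdge.edgeTwo`). -/
def charEdgeTwo (χ : DirichletCharacter ℂ q) (n : ℕ) (T₁ T₂ : ℝ) : ℝ :=
  1 / Real.pi * (χ (2 : ZMod q) * ∫ y in T₁..T₂, (Λ 2 : ℂ) * (2 : ℂ) ^ (-liRightPt y) * (zq y ^ n)⁻¹).re

/-- The coefficients are dominated by `Λ`: `‖χ(m)Λ(m)‖ ≤ ‖Λ(m)‖`. -/
theorem norm_coeff_le (χ : DirichletCharacter ℂ q) (m : ℕ) :
    ‖χ (m : ZMod q) * (Λ m : ℂ)‖ ≤ ‖((Λ m : ℝ) : ℂ)‖ := by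
  rw [norm_mul]
  exact mul_le_of_le_one_left (norm_nonneg _) (DirichletCharacter.norm_le_one χ _)

/-- `‖χ(m)Λ(m) m^{−w}‖ ≤ ‖Λ(m) m^{−3/2}‖` on the edge. -/
theorem norm_term_rightPt_le (χ : DirichletCharacter ℂ q) (y : ℝ) (m : ℕ) :
    ‖LSeries.term (fun m : ℕ ↦ χ (m : ZMod q) * (Λ m : ℂ)) (liRightPt y) m‖
      ≤ ‖LSeries.term (fun m ↦ (Λ m : ℂ)) (3 / 2 : ℂ) m‖ := by
  rw [← norm_term_rightPt y m]
  exact LSeries.norm_term_le _ (norm_coeff_le χ m)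

/-- `χ(m)Λ(m) m^{−w}` as a product. -/
theorem term_eq (χ : DirichletCharacter ℂ q) (y : ℝ) (m : ℕ) :
    LSeries.term (fun m : ℕ ↦ χ (m : ZMod q) * (Λ m : ℂ)) (liRightPt y) m
      = χ (m : ZMod q) * (Λ m : ℂ) * (m : ℂ) ^ (-liRightPt y) :=
  LSeries.term_def₀ (by simp) _ _

/-- `χ(m)Λ(m) m^{−w}` is continuous in `y`. -/
theorem continuous_term (χ : DirichletCharacter ℂ q) (m : ℕ) :
    Continuous fun y ↦ LSeries.term (fun m : ℕ ↦ χ (m : ZMod q) * (Λ m : ℂ)) (liRightPt y) m := by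
  rcases Nat.eq_zero_or_pos m with rfl | hm
  · simp only [LSeries.term_zero]; exact continuous_const
  · simp_rw [term_eq]; exact continuous_const.mul (continuous_cpow_neg_rightPt hm)

/-- `L(χΛ, w)` converges (absolutely) on the edge `Re w = 3/2`. -/
theorem lseriesSummable_rightPt (χ : DirichletCharacter ℂ q) (y : ℝ) :
    LSeriesSummable (fun m : ℕ ↦ χ (m : ZMod q) * (Λ m : ℂ)) (liRightPt y) :=
  Summable.of_norm_bounded summable_norm_term (norm_term_rightPt_le χ y)

/-- **Stub E₂χ (`stub_nonresonant_char`) of the birth skeleton: the non-resonant remainder of the prime edge of `L(s, χ)`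
is `O_c(1)`, uniformly in `χ`.**  For `c ≥ 1` there is `C` with `|charPrimeEdge χ n T₁ T₂ − charEdgeTwo χ n T₁ T₂| ≤ C`
whenever `n ≥ 1`, `√n ≤ T₁ ≤ T₂ ≤ c√n + 1`. -/
theorem charPrimeEdge_nonresonant {c : ℝ} (hc : 1 ≤ c) :
    ∃ C : ℝ, ∀ (χ : DirichletCharacter ℂ q) (n : ℕ), 1 ≤ n → ∀ T₁ T₂ : ℝ, Real.sqrt n ≤ T₁ → T₁ ≤ T₂ →
      T₂ ≤ c * Real.sqrt n + 1 → |charPrimeEdge χ n T₁ T₂ - charEdgeTwo χ n T₁ T₂| ≤ C := by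
  -- adapted from `PrimeEdge.liPrimeEdge_nonresonant` (Theorems/LiPrimeEchoNonresonant.lean, route LiPrimeEcho)
  set Kp : ℝ := 4 + 12 * (c + 1) with hKp
  set Km : ℝ := Real.exp 1 * (22 + 363 * (c + 1)) with hKm
  have hKp0 : 0 ≤ Kp := by rw [hKp]; nlinarith
  have hKm0 : 0 ≤ Km := by rw [hKm]; positivity
  set g : ℕ → ℂ := fun m ↦ (Λ m : ℂ) with hg
  set S : ℝ := ∑' m : ℕ, ‖LSeries.term g (3 / 2 : ℂ) m‖ with hS
  refine ⟨1 / Real.pi * (S * (Kp + Km)), fun χ n hn T₁ T₂ h1 h12 h2 ↦ ?_⟩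
  set f : ℕ → ℂ := fun m : ℕ ↦ χ (m : ZMod q) * (Λ m : ℂ) with hf
  have hsum := summable_norm_term
  -- the term functions
  set F : ℕ → ℝ → ℂ := fun m y ↦ LSeries.term f (liRightPt y) m * liSymWeight n (liRightPt y) with hFdef
  set Tp : ℕ → ℝ → ℂ := fun m y ↦ f m * ((m : ℂ) ^ (-liRightPt y) * zq y ^ n) with hTp
  set Tm : ℕ → ℝ → ℂ := fun m y ↦ f m * ((m : ℂ) ^ (-liRightPt y) * (zq y ^ n)⁻¹) with hTm
  have hF : ∀ m y, F m y = Tp m y + Tm m y := by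
    intro m y; simp only [hFdef, hTp, hTm, hf, term_eq, liSymWeight_rightPt]; ring
  -- dominated convergence: `HasSum (∫ F m) (∫ L k_n)`
  have hJ : HasSum (fun m ↦ ∫ y in T₁..T₂, F m y)
      (∫ y in T₁..T₂, LSeries f (liRightPt y) * liSymWeight n (liRightPt y)) := by
    refine intervalIntegral.hasSum_integral_of_dominated_convergence
      (fun m _ ↦ ‖LSeries.term g (3 / 2 : ℂ) m‖ * (1 + Real.exp 1)) ?_ ?_ ?_ ?_ ?_
    · intro m; exact ((continuous_term χ m).mul (continuous_symWeight n)).aestronglyMeasurable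
    · intro m
      refine Filter.Eventually.of_forall fun y hy ↦ ?_
      rw [uIoc_of_le h12] at hy
      have hy' : Real.sqrt n ≤ y := h1.trans hy.1.le
      simp only [hFdef]
      rw [norm_mul]
      refine mul_le_mul (norm_term_rightPt_le χ y m) ?_ (norm_nonneg _) (norm_nonneg _)
      rw [liSymWeight_rightPt]
      exact (norm_add_le _ _).trans (add_le_add (norm_zq_pow_le_one n y) (norm_zq_pow_inv_le n hy'))
    · refine Filter.Eventually.of_forall fun y _ ↦ ?_
      show Summable fun m ↦ ‖LSeries.term g (3 / 2 : ℂ) m‖ * (1 + Real.exp 1)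
      exact hsum.mul_right (1 + Real.exp 1)
    · show IntervalIntegrable (fun _ : ℝ ↦ ∑' m : ℕ, ‖LSeries.term g (3 / 2 : ℂ) m‖ * (1 + Real.exp 1)) volume T₁ T₂
      exact intervalIntegrable_const
    · refine Filter.Eventually.of_forall fun y _ ↦ ?_
      show HasSum (fun m ↦ LSeries.term f (liRightPt y) m * liSymWeight n (liRightPt y))
        (LSeries f (liRightPt y) * liSymWeight n (liRightPt y))
      exact (lseriesSummable_rightPt χ y).hasSum.mul_right (liSymWeight n (liRightPt y))
  -- the term integrals split
  have hiTp : ∀ m, IntervalIntegrable (Tp m) volume T₁ T₂ := fun m ↦ by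
    rcases Nat.eq_zero_or_pos m with rfl | hm
    · simp only [hTp, hf, ArithmeticFunction.map_zero, Complex.ofReal_zero, mul_zero, zero_mul]
      exact intervalIntegrable_const
    · exact (continuous_const.mul ((continuous_cpow_neg_rightPt hm).mul (continuous_zq.pow n))).intervalIntegrable _ _
  have hiTm : ∀ m, IntervalIntegrable (Tm m) volume T₁ T₂ := fun m ↦ by
    rcases Nat.eq_zero_or_pos m with rfl | hm
    · simp only [hTm, hf, ArithmeticFunction.map_zero, Complex.ofReal_zero, mul_zero, zero_mul]
      exact intervalIntegrable_const
    · exact (continuous_const.mul ((continuous_cpow_neg_rightPt hm).mul (continuous_zq_pow_inv n))).intervalIntegrable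
        _ _
  have hsplit : ∀ m, (∫ y in T₁..T₂, F m y) = (∫ y in T₁..T₂, Tp m y) + ∫ y in T₁..T₂, Tm m y := fun m ↦ by
    rw [← intervalIntegral.integral_add (hiTp m) (hiTm m)]
    exact intervalIntegral.integral_congr fun y _ ↦ hF m y
  -- `‖χ(m)Λ(m)‖ ≤ Λ(m)`
  have hfm : ∀ m, ‖f m‖ ≤ (Λ m : ℝ) := fun m ↦ by
    refine (norm_coeff_le χ m).trans ?_
    rw [Complex.norm_real, Real.norm_eq_abs, abs_of_nonneg ArithmeticFunction.vonMangoldt_nonneg]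
  -- per-term bounds
  have hbTp : ∀ m, ‖∫ y in T₁..T₂, Tp m y‖ ≤ ‖LSeries.term g (3 / 2 : ℂ) m‖ * Kp := by
    intro m
    rcases lt_or_ge m 2 with hm | hm
    · have h0 := vonMangoldt_eq_zero_of_lt_two hm
      simp only [hTp, hf, h0, Complex.ofReal_zero, mul_zero, zero_mul, intervalIntegral.integral_zero, norm_zero]
      positivity
    · have hm0 : 0 < m := by omega
      simp only [hTp]
      rw [intervalIntegral.integral_const_mul, norm_mul, norm_term_three_halves hm0, mul_assoc]
      exact mul_le_mul (hfm m) (norm_integral_plus_le hc hn hm h1 h12 h2) (norm_nonneg _)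
        ArithmeticFunction.vonMangoldt_nonneg
  have hbTm : ∀ m, m ≠ 2 → ‖∫ y in T₁..T₂, Tm m y‖ ≤ ‖LSeries.term g (3 / 2 : ℂ) m‖ * Km := by
    intro m hm2
    rcases lt_or_ge m 2 with hm | hm
    · have h0 := vonMangoldt_eq_zero_of_lt_two hm
      simp only [hTm, hf, h0, Complex.ofReal_zero, mul_zero, zero_mul, intervalIntegral.integral_zero, norm_zero]
      positivity
    · have hm3 : 3 ≤ m := by omega
      have hm0 : 0 < m := by omega
      simp only [hTm]
      rw [intervalIntegral.integral_const_mul, norm_mul, norm_term_three_halves hm0, mul_assoc]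
      exact mul_le_mul (hfm m) (norm_integral_minus_le hc hn hm3 h1 h12 h2) (norm_nonneg _)
        ArithmeticFunction.vonMangoldt_nonneg
  -- assemble: `∫ L k_n − ∫ Tm 2 = Σ_m (∫ Tp m + [m ≠ 2] ∫ Tm m)`
  set J : ℂ := ∫ y in T₁..T₂, LSeries f (liRightPt y) * liSymWeight n (liRightPt y) with hJdef
  set I2 : ℂ := ∫ y in T₁..T₂, Tm 2 y with hI2
  set G : ℕ → ℂ := fun m ↦ (∫ y in T₁..T₂, Tp m y) + if m = 2 then 0 else ∫ y in T₁..T₂, Tm m y with hG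
  have hGsum : HasSum G (J - I2) := by
    have h2 := hasSum_ite_eq 2 I2
    have e : G = fun m ↦ (∫ y in T₁..T₂, F m y) - (if m = 2 then I2 else 0) := by
      funext m
      simp only [hG, hsplit]
      split_ifs with h
      · subst h; rw [hI2]; ring
      · ring
    rw [e]
    exact hJ.sub h2
  have hGb : ∀ m, ‖G m‖ ≤ ‖LSeries.term g (3 / 2 : ℂ) m‖ * (Kp + Km) := by
    intro m
    simp only [hG]
    split_ifs with h
    · rw [add_zero, mul_add]
      have : 0 ≤ ‖LSeries.term g (3 / 2 : ℂ) m‖ * Km := by positivity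
      linarith [hbTp m]
    · rw [mul_add]
      exact (norm_add_le _ _).trans (add_le_add (hbTp m) (hbTm m h))
  have hnorm : ‖J - I2‖ ≤ S * (Kp + Km) := by
    rw [← hGsum.tsum_eq]
    have := tsum_of_norm_bounded (hsum.mul_right (Kp + Km)).hasSum hGb
    rwa [tsum_mul_right] at this
  -- back to the real statement
  have hfinal : charPrimeEdge χ n T₁ T₂ - charEdgeTwo χ n T₁ T₂ = 1 / Real.pi * (J - I2).re := by
    have hI2' : I2 = χ (2 : ZMod q) * ∫ y in T₁..T₂, (Λ 2 : ℂ) * (2 : ℂ) ^ (-liRightPt y) * (zq y ^ n)⁻¹ := by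
      rw [hI2, ← intervalIntegral.integral_const_mul]
      refine intervalIntegral.integral_congr fun y _ ↦ ?_
      simp only [hTm, hf, Nat.cast_ofNat]
      ring
    unfold charPrimeEdge charEdgeTwo
    rw [Complex.sub_re, hI2', hJdef]
    ring
  rw [hfinal, abs_mul, abs_of_pos (by positivity : (0 : ℝ) < 1 / Real.pi)]
  refine mul_le_mul_of_nonneg_left ?_ (by positivity)
  exact (Complex.abs_re_le_norm _).trans hnorm

end CharPrimeEdge

end Summit.RiemannHypothesis.RiemannHypothesis.Theorems.LiTheory
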